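import Mathlib.Algebra.Group.ForwardDiff
import Mathlib.Algebra.QuadraticDiscriminant
import Mathlib.Analysis.SpecificLimits.Basic
import Mathlib.Logic.Equiv.Fin.Basic
import HarnessLib

/-!
# Positive-definite functions on the additive semigroup `(0, ∞)`

A function `f : ℝ → ℝ` is **positive definite on the open additive semigroup** `((0,∞), +)` if
`∑ᵢⱼ cᵢ cⱼ f(sᵢ + sⱼ) ≥ 0` for all finite families of points `sᵢ > 0` and real coefficients `cᵢ`
[cite: BergChristensenRessel1984, Ch. 4 §1 Def. 1.1 (positive definite functions on an abelian
semigroup with involution, here `s* = s`)].  By the theorem of Bernstein–Widder /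
Berg–Christensen–Ressel, the positive definite functions that are bounded on every `[t₀, ∞)` are
exactly the Laplace transforms of positive measures on `[0, ∞)`, i.e. the completely monotone
functions [cite: BergChristensenRessel1984, Ch. 4 Thm. 6.13 and §4.4], [cite: Widder1941, Ch. IV
Thm. 12a and Ch. VI Thm. 21 ("exponentially convex" functions)].

This file proves the elementary, measure-free half of that circle of ideas which the tree needs.
Throughout, positive definiteness is the HYPOTHESIS written out,
`∀ m (s c : Fin m → ℝ), (∀ a, 0 < s a) → 0 ≤ ∑ a, ∑ b, c a * c b * f (s a + s b)`, and "bounded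
above on every `[t₀,∞)`" is `∀ t₀ > 0, ∃ M, ∀ τ ≥ t₀, f τ ≤ M` (no new definitions are introduced).

* `SemigroupPosDef.sq_le_mul` — Cauchy–Schwarz of the kernel `f(s + t)` along a translate:
  `Q(u)² ≤ Q(0) Q(2u)` for the quadratic forms `Q(u) = ∑ cᵢ cⱼ f(sᵢ + sⱼ + u)`;
* `SemigroupPosDef.sub_shift` — **the translation semigroup is contractive**: if `f` is positive
  definite and bounded above on every `[t₀, ∞)`, then `Q(u) ≤ Q(0)`, i.e. `t ↦ f t - f (t + u)` is
  again positive definite (`u ≥ 0`) and bounded above on every `[t₀,∞)`;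
* `SemigroupPosDef.iter_fwdDiff_nonneg` — consequently all iterated forward differences
  alternate in sign: `0 ≤ (-1)^n Δ_[u]^[n] f (t)` for `u ≥ 0`, `t > 0` (`f` is "completely
  monotone in the difference sense"), and `f` is non-increasing on `(0,∞)`.

The complementary steps (difference-monotone ⇒ smooth completely monotone ⇒ holomorphic in the
right half-plane) are in `SemigroupPosDefSmooth.lean` and `Literature/Analysis/Complex/`.

## Mathlib

Uses `fwdDiff` (`Δ_[h]`, `Mathlib/Algebra/Group/ForwardDiff`) and `discrim_le_zero`.  Mathlib has
no positive-definite functions on semigroups and no Bernstein–Widder theory (searched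
`completely monotone`, `Bernstein`, `Laplace transform`; only `AbsolutelyMonotoneOn`, a definition).
-/

noncomputable section

open Finset Filter
open scoped BigOperators fwdDiff Topology

namespace Literature.Analysis.SpecialFunctions

namespace SemigroupPosDef

variable {f g : ℝ → ℝ}

/-- The defining inequality for families indexed by an arbitrary finite type. [folklore] -/
theorem sum_nonneg {ι : Type*} [Fintype ι] (h : (∀ (m : ℕ) (s c : Fin m → ℝ), (∀ k₀, 0 < s k₀) → 0 ≤ ∑ i₁, ∑ i₂, c i₁ * c i₂ * (f (s i₁ + s i₂)))) (s : ι → ℝ) (c : ι → ℝ)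
    (hs : ∀ i, 0 < s i) : 0 ≤ ∑ i, ∑ j, c i * c j * f (s i + s j) := by
  classical
  set e := (Fintype.equivFin ι).symm with he
  have h' := h (Fintype.card ι) (s ∘ e) (c ∘ e) fun a => hs _
  simp only [Function.comp_apply] at h'
  have h1 : ∑ i, ∑ j, c (e i) * c (e j) * f (s (e i) + s (e j)) =
      ∑ i, ∑ j, c i * c j * f (s i + s j) := by
    rw [e.sum_comp (fun i => ∑ j, c i * c (e j) * f (s i + s (e j)))]
    exact Finset.sum_congr rfl fun i _ => e.sum_comp (fun j => c i * c j * f (s i + s j))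
  rwa [h1] at h'

/-- Positive definiteness only depends on the values on `(0, ∞)`. [folklore] -/
theorem congr (h : (∀ (m : ℕ) (s c : Fin m → ℝ), (∀ k₀, 0 < s k₀) → 0 ≤ ∑ i₁, ∑ i₂, c i₁ * c i₂ * (f (s i₁ + s i₂)))) (hfg : ∀ t, 0 < t → f t = g t) : (∀ (m : ℕ) (s c : Fin m → ℝ), (∀ k₀, 0 < s k₀) → 0 ≤ ∑ i₁, ∑ i₂, c i₁ * c i₂ * (g (s i₁ + s i₂))) := by
  intro m s c hs
  have := h m s c hs
  refine this.trans_eq (Finset.sum_congr rfl fun a _ => Finset.sum_congr rfl fun b _ => ?_)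
  rw [hfg _ (add_pos (hs a) (hs b))]

/-- "Bounded above on every `[t₀,∞)`" only depends on the values on `(0, ∞)`. [folklore] -/
theorem bdd_congr (h : (∀ t₀ : ℝ, 0 < t₀ → ∃ M : ℝ, ∀ τ : ℝ, t₀ ≤ τ → (f τ) ≤ M)) (hfg : ∀ t, 0 < t → f t = g t) : (∀ t₀ : ℝ, 0 < t₀ → ∃ M : ℝ, ∀ τ : ℝ, t₀ ≤ τ → (g τ) ≤ M) := by
  intro t₀ ht₀
  obtain ⟨M, hM⟩ := h t₀ ht₀
  exact ⟨M, fun t ht => (hfg t (ht₀.trans_le ht)) ▸ hM t ht⟩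

/-- A positive definite function is nonnegative on `(0, ∞)` (one point `s = t/2`). [folklore] -/
theorem nonneg (h : (∀ (m : ℕ) (s c : Fin m → ℝ), (∀ k₀, 0 < s k₀) → 0 ≤ ∑ i₁, ∑ i₂, c i₁ * c i₂ * (f (s i₁ + s i₂)))) {t : ℝ} (ht : 0 < t) : 0 ≤ f t := by
  have := h 1 (fun _ => t / 2) (fun _ => 1) (fun _ => by positivity)
  simpa [add_halves] using this

/-- Translates `t ↦ f (t + u)`, `u ≥ 0`, of a positive definite function are positive definite
(use the points `sᵢ + u/2`). [folklore] -/
theorem shift (h : (∀ (m : ℕ) (s c : Fin m → ℝ), (∀ k₀, 0 < s k₀) → 0 ≤ ∑ i₁, ∑ i₂, c i₁ * c i₂ * (f (s i₁ + s i₂)))) {u : ℝ} (hu : 0 ≤ u) : (∀ (m : ℕ) (s c : Fin m → ℝ), (∀ k₀, 0 < s k₀) → 0 ≤ ∑ i₁, ∑ i₂, c i₁ * c i₂ * (f ((s i₁ + s i₂) + u))) := by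
  intro m s c hs
  have := h m (fun a => s a + u / 2) c (fun a => by have := hs a; positivity)
  refine this.trans_eq (Finset.sum_congr rfl fun a _ => Finset.sum_congr rfl fun b _ => ?_)
  ring_nf

/-- Sums of positive definite functions are positive definite. [folklore] -/
theorem add (hf : (∀ (m : ℕ) (s c : Fin m → ℝ), (∀ k₀, 0 < s k₀) → 0 ≤ ∑ i₁, ∑ i₂, c i₁ * c i₂ * (f (s i₁ + s i₂)))) (hg : (∀ (m : ℕ) (s c : Fin m → ℝ), (∀ k₀, 0 < s k₀) → 0 ≤ ∑ i₁, ∑ i₂, c i₁ * c i₂ * (g (s i₁ + s i₂)))) : (∀ (m : ℕ) (s c : Fin m → ℝ), (∀ k₀, 0 < s k₀) → 0 ≤ ∑ i₁, ∑ i₂, c i₁ * c i₂ * (f (s i₁ + s i₂) + g (s i₁ + s i₂))) := by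
  intro m s c hs
  have h1 := hf m s c hs
  have h2 := hg m s c hs
  have : ∑ a, ∑ b, c a * c b * (f (s a + s b) + g (s a + s b)) =
      (∑ a, ∑ b, c a * c b * f (s a + s b)) + ∑ a, ∑ b, c a * c b * g (s a + s b) := by
    simp only [mul_add, Finset.sum_add_distrib]
  rw [this]; exact add_nonneg h1 h2

/-- Nonnegative multiples of positive definite functions are positive definite. [folklore] -/
theorem const_mul (hf : (∀ (m : ℕ) (s c : Fin m → ℝ), (∀ k₀, 0 < s k₀) → 0 ≤ ∑ i₁, ∑ i₂, c i₁ * c i₂ * (f (s i₁ + s i₂)))) {r : ℝ} (hr : 0 ≤ r) : (∀ (m : ℕ) (s c : Fin m → ℝ), (∀ k₀, 0 < s k₀) → 0 ≤ ∑ i₁, ∑ i₂, c i₁ * c i₂ * (r * f (s i₁ + s i₂))) := by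
  intro m s c hs
  have h1 := hf m s c hs
  have : ∑ a, ∑ b, c a * c b * (r * f (s a + s b)) = r * ∑ a, ∑ b, c a * c b * f (s a + s b) := by
    rw [Finset.mul_sum]; refine Finset.sum_congr rfl fun a _ => ?_
    rw [Finset.mul_sum]; exact Finset.sum_congr rfl fun b _ => by ring
  rw [this]; exact mul_nonneg hr h1

/-- The translated quadratic forms `Q(u) = ∑ cᵢ cⱼ f(sᵢ + sⱼ + u)` of a positive definite function
are nonnegative (`u ≥ 0`). [folklore] -/
theorem quadForm_nonneg (h : (∀ (m : ℕ) (s c : Fin m → ℝ), (∀ k₀, 0 < s k₀) → 0 ≤ ∑ i₁, ∑ i₂, c i₁ * c i₂ * (f (s i₁ + s i₂)))) {m : ℕ} {s : Fin m → ℝ} (c : Fin m → ℝ)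
    (hs : ∀ a, 0 < s a) {u : ℝ} (hu : 0 ≤ u) : 0 ≤ ∑ a, ∑ b, c a * c b * f (s a + s b + u) :=
  shift h hu m s c hs

/-- **Cauchy–Schwarz along the translation semigroup**: `Q(u)² ≤ Q(0) · Q(2u)` for the quadratic
forms `Q(u) = ∑ cᵢ cⱼ f(sᵢ + sⱼ + u)` of a positive definite `f` (`u ≥ 0`).  Proof: positivity on
the doubled family `{sᵢ} ∪ {sᵢ + u}` with coefficients `x cᵢ`, `cᵢ` is a nonnegative binary
quadratic form in `x`. [cite: BergChristensenRessel1984, Ch. 4 §1 (1.6)–(1.8)] -/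
theorem sq_le_mul (h : (∀ (m : ℕ) (s c : Fin m → ℝ), (∀ k₀, 0 < s k₀) → 0 ≤ ∑ i₁, ∑ i₂, c i₁ * c i₂ * (f (s i₁ + s i₂)))) {m : ℕ} {s : Fin m → ℝ} (c : Fin m → ℝ)
    (hs : ∀ a, 0 < s a) {u : ℝ} (hu : 0 ≤ u) :
    (∑ a, ∑ b, c a * c b * f (s a + s b + u)) ^ 2 ≤
      (∑ a, ∑ b, c a * c b * f (s a + s b)) * ∑ a, ∑ b, c a * c b * f (s a + s b + 2 * u) := by
  -- the doubled configuration, indexed by `Fin m ⊕ Fin m`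
  have key : ∀ x : ℝ, 0 ≤ (∑ a, ∑ b, c a * c b * f (s a + s b)) * (x * x) +
      2 * (∑ a, ∑ b, c a * c b * f (s a + s b + u)) * x +
      ∑ a, ∑ b, c a * c b * f (s a + s b + 2 * u) := by
    intro x
    let p : Fin m ⊕ Fin m → ℝ := Sum.elim s (fun a => s a + u)
    let d : Fin m ⊕ Fin m → ℝ := Sum.elim (fun a => x * c a) c
    have hp : ∀ i, 0 < p i := by
      rintro (a | a)
      · exact hs a
      · exact add_pos_of_pos_of_nonneg (hs a) hu
    have h0 := sum_nonneg h p d hp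
    have hexp : ∑ i, ∑ j, d i * d j * f (p i + p j) =
        (∑ a, ∑ b, c a * c b * f (s a + s b)) * (x * x) +
        2 * (∑ a, ∑ b, c a * c b * f (s a + s b + u)) * x +
        ∑ a, ∑ b, c a * c b * f (s a + s b + 2 * u) := by
      simp only [Fintype.sum_sum_type, p, d, Sum.elim_inl, Sum.elim_inr, Finset.sum_add_distrib]
      have e1 : ∑ a, ∑ b, x * c a * (x * c b) * f (s a + s b) =
          (∑ a, ∑ b, c a * c b * f (s a + s b)) * (x * x) := by
        rw [Finset.sum_mul]; refine Finset.sum_congr rfl fun a _ => ?_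
        rw [Finset.sum_mul]; exact Finset.sum_congr rfl fun b _ => by ring
      have e2 : ∑ a, ∑ b, x * c a * c b * f (s a + (s b + u)) =
          (∑ a, ∑ b, c a * c b * f (s a + s b + u)) * x := by
        rw [Finset.sum_mul]; refine Finset.sum_congr rfl fun a _ => ?_
        rw [Finset.sum_mul]; exact Finset.sum_congr rfl fun b _ => by rw [add_assoc]; ring
      have e3 : ∑ a, ∑ b, c a * (x * c b) * f (s a + u + s b) =
          (∑ a, ∑ b, c a * c b * f (s a + s b + u)) * x := by
        rw [Finset.sum_mul]; refine Finset.sum_congr rfl fun a _ => ?_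
        rw [Finset.sum_mul]; exact Finset.sum_congr rfl fun b _ => by
          rw [show s a + u + s b = s a + s b + u by ring]; ring
      have e4 : ∑ a, ∑ b, c a * c b * f (s a + u + (s b + u)) =
          ∑ a, ∑ b, c a * c b * f (s a + s b + 2 * u) :=
        Finset.sum_congr rfl fun a _ => Finset.sum_congr rfl fun b _ => by
          rw [show s a + u + (s b + u) = s a + s b + 2 * u by ring]
      rw [e1, e2, e3, e4]; ring
    rwa [hexp] at h0
  have hd := discrim_le_zero key
  rw [discrim] at hd
  nlinarith [hd]

/-- A family of positive reals indexed by `Fin m` has a positive lower bound. [folklore] -/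
theorem exists_pos_le {m : ℕ} (s : Fin m → ℝ) (hs : ∀ a, 0 < s a) :
    ∃ t₀ : ℝ, 0 < t₀ ∧ ∀ a, t₀ ≤ s a := by
  rcases isEmpty_or_nonempty (Fin m) with hm | hm
  · exact ⟨1, one_pos, fun a => (hm.false a).elim⟩
  · obtain ⟨a₀, ha₀⟩ := Finite.exists_min s
    exact ⟨s a₀, hs a₀, ha₀⟩

/-- The quadratic forms `Q(u)`, `u ≥ 0`, of a positive definite function bounded above on every
`[t₀,∞)` are bounded uniformly in `u`. [folklore] -/
theorem quadForm_le (h : (∀ (m : ℕ) (s c : Fin m → ℝ), (∀ k₀, 0 < s k₀) → 0 ≤ ∑ i₁, ∑ i₂, c i₁ * c i₂ * (f (s i₁ + s i₂)))) (hb : (∀ t₀ : ℝ, 0 < t₀ → ∃ M : ℝ, ∀ τ : ℝ, t₀ ≤ τ → (f τ) ≤ M)) {m : ℕ} (s c : Fin m → ℝ)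
    (hs : ∀ a, 0 < s a) : ∃ B : ℝ, ∀ u, 0 ≤ u → ∑ a, ∑ b, c a * c b * f (s a + s b + u) ≤ B := by
  obtain ⟨t₀, ht₀, hst⟩ := exists_pos_le s hs
  obtain ⟨M, hM⟩ := hb t₀ ht₀
  refine ⟨∑ a, ∑ b, |c a| * |c b| * M, fun u hu => ?_⟩
  refine Finset.sum_le_sum fun a _ => Finset.sum_le_sum fun b _ => ?_
  have hpos : 0 < s a + s b + u := by linarith [hs a, hs b]
  have hf0 : 0 ≤ f (s a + s b + u) := nonneg h hpos
  have hfM : f (s a + s b + u) ≤ M := hM _ (by linarith [hst a, hst b, hs a])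
  calc c a * c b * f (s a + s b + u) ≤ |c a * c b| * f (s a + s b + u) :=
        mul_le_mul_of_nonneg_right (le_abs_self _) hf0
    _ = |c a| * |c b| * f (s a + s b + u) := by rw [abs_mul]
    _ ≤ |c a| * |c b| * M := mul_le_mul_of_nonneg_left hfM (by positivity)

/-- **The translation semigroup is contractive** (the key step of Bernstein–Widder without
measures): if `f` is positive definite on `(0,∞)` and bounded above on every `[t₀, ∞)`, then
`Q(u) ≤ Q(0)` for `u ≥ 0`, i.e. `∑ cᵢ cⱼ [f(sᵢ+sⱼ) - f(sᵢ+sⱼ+u)] ≥ 0`.  Proof: iterate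
`Q(v)² ≤ Q(0) Q(2v)` along `v = 2ᵏ u`; if `Q(u) > Q(0) > 0` the ratios `(Q(u)/Q(0))^{2^k}` would be
unbounded, contradicting the uniform bound on `Q(2ᵏu)`. [cite: BergChristensenRessel1984, Ch. 4 §1 Prop. 1.12] -/
theorem quadForm_le_quadForm_zero (h : (∀ (m : ℕ) (s c : Fin m → ℝ), (∀ k₀, 0 < s k₀) → 0 ≤ ∑ i₁, ∑ i₂, c i₁ * c i₂ * (f (s i₁ + s i₂)))) (hb : (∀ t₀ : ℝ, 0 < t₀ → ∃ M : ℝ, ∀ τ : ℝ, t₀ ≤ τ → (f τ) ≤ M)) {m : ℕ}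
    {s : Fin m → ℝ} (c : Fin m → ℝ) (hs : ∀ a, 0 < s a) {u : ℝ} (hu : 0 ≤ u) :
    ∑ a, ∑ b, c a * c b * f (s a + s b + u) ≤ ∑ a, ∑ b, c a * c b * f (s a + s b) := by
  set N := ∑ a, ∑ b, c a * c b * f (s a + s b) with hN
  set a : ℕ → ℝ := fun k => ∑ a, ∑ b, c a * c b * f (s a + s b + 2 ^ k * u) with ha
  have ha0 : a 0 = ∑ a, ∑ b, c a * c b * f (s a + s b + u) := by simp [ha]
  have hank : ∀ k, 0 ≤ a k := fun k => quadForm_nonneg h c hs (by positivity)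
  have hN0 : 0 ≤ N := by simpa [hN] using quadForm_nonneg h c hs (le_refl (0:ℝ))
  have hstep : ∀ k, a k ^ 2 ≤ N * a (k + 1) := by
    intro k
    have := sq_le_mul h c hs (u := 2 ^ k * u) (by positivity)
    simpa [ha, hN, pow_succ, mul_comm, mul_assoc, mul_left_comm] using this
  obtain ⟨B, hB⟩ := quadForm_le h hb s c hs
  have haB : ∀ k, a k ≤ B := fun k => hB _ (by positivity)
  rw [← ha0]
  by_contra hlt
  push Not at hlt
  -- `N < a 0`; first `N ≠ 0`
  rcases hN0.eq_or_lt with hN00 | hNpos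
  · have h0 := hstep 0
    rw [← hN00, zero_mul] at h0
    have : a 0 = 0 := by nlinarith [hank 0]
    rw [this] at hlt
    exact absurd hlt (not_lt.mpr hN0)
  · -- ratio `r = a 0 / N > 1` and `a k ≥ N r^{2^k}`
    set r := a 0 / N with hr
    have hr1 : 1 < r := by rw [hr, one_lt_div hNpos]; exact hlt
    have hlow : ∀ k, N * r ^ (2 ^ k) ≤ a k := by
      intro k
      induction k with
      | zero => simp [hr, mul_div_cancel₀ _ hNpos.ne']
      | succ k ih =>
        have h1 : (N * r ^ 2 ^ k) ^ 2 ≤ a k ^ 2 := by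
          have : 0 ≤ N * r ^ 2 ^ k := by positivity
          exact pow_le_pow_left₀ this ih 2
        have h2 := hstep k
        have h3 : (N * r ^ 2 ^ k) ^ 2 = N * (N * r ^ 2 ^ (k + 1)) := by ring
        nlinarith [h1, h2, h3]
    -- contradiction with boundedness: `r^(2^k) ≥ r^k → ∞`
    have htend : Tendsto (fun k : ℕ => N * r ^ k) atTop atTop :=
      Tendsto.const_mul_atTop hNpos (tendsto_pow_atTop_atTop_of_one_lt hr1)
    obtain ⟨k, hk⟩ := (htend.eventually_gt_atTop B).exists
    have hmono : N * r ^ k ≤ N * r ^ (2 ^ k) := by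
      refine mul_le_mul_of_nonneg_left (pow_le_pow_right₀ hr1.le ?_) hN0
      exact (Nat.lt_two_pow_self).le
    exact absurd ((hk.trans_le hmono).trans_le ((hlow k).trans (haB k))) (lt_irrefl _)

/-- **Closure under `f ↦ f - f(· + u)`.**  If `f` is positive definite on `(0,∞)` and bounded above
on every `[t₀,∞)`, then so is `t ↦ f t - f (t + u)` for every `u ≥ 0` (it is `≤ f`, and positive
definite by `quadForm_le_quadForm_zero`). [cite: BergChristensenRessel1984, Ch. 4 §1 Prop. 1.12] -/
theorem sub_shift (h : (∀ (m : ℕ) (s c : Fin m → ℝ), (∀ k₀, 0 < s k₀) → 0 ≤ ∑ i₁, ∑ i₂, c i₁ * c i₂ * (f (s i₁ + s i₂)))) (hb : (∀ t₀ : ℝ, 0 < t₀ → ∃ M : ℝ, ∀ τ : ℝ, t₀ ≤ τ → (f τ) ≤ M)) {u : ℝ} (hu : 0 ≤ u) :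
    (∀ (m : ℕ) (s c : Fin m → ℝ), (∀ k₀, 0 < s k₀) → 0 ≤ ∑ i₁, ∑ i₂, c i₁ * c i₂ * (f (s i₁ + s i₂) - f ((s i₁ + s i₂) + u))) ∧ (∀ t₀ : ℝ, 0 < t₀ → ∃ M : ℝ, ∀ τ : ℝ, t₀ ≤ τ → (f τ - f (τ + u)) ≤ M) := by
  refine ⟨fun m s c hs => ?_, fun t₀ ht₀ => ?_⟩
  · have key := quadForm_le_quadForm_zero h hb c hs hu
    have : ∑ a, ∑ b, c a * c b * (f (s a + s b) - f (s a + s b + u)) =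
        (∑ a, ∑ b, c a * c b * f (s a + s b)) - ∑ a, ∑ b, c a * c b * f (s a + s b + u) := by
      simp only [mul_sub, Finset.sum_sub_distrib]
    rw [this]; linarith
  · obtain ⟨M, hM⟩ := hb t₀ ht₀
    refine ⟨M, fun t ht => ?_⟩
    have : 0 ≤ f (t + u) := nonneg h (by linarith)
    linarith [hM t ht]

/-- `-Δ_[u]` preserves the class (restatement of `sub_shift` with Mathlib's forward difference
`Δ_[u] f t = f (t + u) - f t`). [folklore] -/
theorem neg_fwdDiff (h : (∀ (m : ℕ) (s c : Fin m → ℝ), (∀ k₀, 0 < s k₀) → 0 ≤ ∑ i₁, ∑ i₂, c i₁ * c i₂ * (f (s i₁ + s i₂)))) (hb : (∀ t₀ : ℝ, 0 < t₀ → ∃ M : ℝ, ∀ τ : ℝ, t₀ ≤ τ → (f τ) ≤ M)) {u : ℝ} (hu : 0 ≤ u) :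
    (∀ (m : ℕ) (s c : Fin m → ℝ), (∀ k₀, 0 < s k₀) → 0 ≤ ∑ i₁, ∑ i₂, c i₁ * c i₂ * ((-Δ_[u] f) (s i₁ + s i₂))) ∧ (∀ t₀ : ℝ, 0 < t₀ → ∃ M : ℝ, ∀ τ : ℝ, t₀ ≤ τ → ((-Δ_[u] f) τ) ≤ M) := by
  have e : -Δ_[u] f = fun t => f t - f (t + u) := by
    ext t; simp [fwdDiff]
  rw [e]; exact sub_shift h hb hu

/-- **Iterated differences alternate in sign** ("complete monotonicity in the difference sense"):
for `f` positive definite on `(0,∞)` and bounded above on every `[t₀,∞)`, the function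
`(-1)ⁿ Δ_[u]^[n] f` is again positive definite and bounded above on every `[t₀,∞)`, for all
`u ≥ 0`. [cite: Widder1941, Ch. IV §2 Def. 2b and Ch. VI Thm. 21] -/
theorem iter_neg_fwdDiff (h : (∀ (m : ℕ) (s c : Fin m → ℝ), (∀ k₀, 0 < s k₀) → 0 ≤ ∑ i₁, ∑ i₂, c i₁ * c i₂ * (f (s i₁ + s i₂)))) (hb : (∀ t₀ : ℝ, 0 < t₀ → ∃ M : ℝ, ∀ τ : ℝ, t₀ ≤ τ → (f τ) ≤ M)) {u : ℝ} (hu : 0 ≤ u) (n : ℕ) :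
    (∀ (m : ℕ) (s c : Fin m → ℝ), (∀ k₀, 0 < s k₀) → 0 ≤ ∑ i₁, ∑ i₂, c i₁ * c i₂ * (((-1 : ℝ) ^ n • (Δ_[u]^[n] f)) (s i₁ + s i₂))) ∧ (∀ t₀ : ℝ, 0 < t₀ → ∃ M : ℝ, ∀ τ : ℝ, t₀ ≤ τ → (((-1 : ℝ) ^ n • (Δ_[u]^[n] f)) τ) ≤ M) := by
  induction n with
  | zero => simpa using And.intro h hb
  | succ n ih =>
    have h1 := neg_fwdDiff ih.1 ih.2 hu
    have e : -Δ_[u] ((-1 : ℝ) ^ n • Δ_[u]^[n] f) = (-1 : ℝ) ^ (n + 1) • Δ_[u]^[n + 1] f := by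
      rw [fwdDiff_const_smul, Function.iterate_succ_apply', pow_succ, mul_comm, ← smul_smul]
      ext t; simp
    rw [e] at h1
    exact h1

/-- Pointwise form: `0 ≤ (-1)ⁿ Δ_[u]^[n] f t` for `u ≥ 0`, `t > 0`. [cite: Widder1941, Ch. VI Thm. 21] -/
theorem iter_fwdDiff_nonneg (h : (∀ (m : ℕ) (s c : Fin m → ℝ), (∀ k₀, 0 < s k₀) → 0 ≤ ∑ i₁, ∑ i₂, c i₁ * c i₂ * (f (s i₁ + s i₂)))) (hb : (∀ t₀ : ℝ, 0 < t₀ → ∃ M : ℝ, ∀ τ : ℝ, t₀ ≤ τ → (f τ) ≤ M)) {u : ℝ} (hu : 0 ≤ u)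
    (n : ℕ) {t : ℝ} (ht : 0 < t) : 0 ≤ (-1 : ℝ) ^ n * Δ_[u]^[n] f t := by
  have := nonneg (iter_neg_fwdDiff h hb hu n).1 ht
  simpa using this

/-- In particular `f` is non-increasing on `(0, ∞)`. [folklore] -/
theorem antitoneOn (h : (∀ (m : ℕ) (s c : Fin m → ℝ), (∀ k₀, 0 < s k₀) → 0 ≤ ∑ i₁, ∑ i₂, c i₁ * c i₂ * (f (s i₁ + s i₂)))) (hb : (∀ t₀ : ℝ, 0 < t₀ → ∃ M : ℝ, ∀ τ : ℝ, t₀ ≤ τ → (f τ) ≤ M)) : AntitoneOn f (Set.Ioi 0) := by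
  intro x hx y _ hxy
  have := iter_fwdDiff_nonneg h hb (sub_nonneg.mpr hxy) 1 hx
  simp [fwdDiff] at this
  linarith

end SemigroupPosDef

end Literature.Analysis.SpecialFunctions
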